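import Mathlib
import Literature.NumberTheory.LFunctions.Zhang2022.Section16AU018WOfU015W
import HarnessLib

/-!
# Zhang (2022) §16, (16.5) and (16.12) from the WEIGHTED u015/u018: the end of the bookkeeping twin

Topic `Literature/NumberTheory/LFunctions/Zhang2022` (Landau–Siegel audit tree; verdict-neutral).
Y. Zhang, *Discrete mean estimates and the Landau–Siegel zero*, arXiv:2211.02515v1 (2022)
[Zhang2022LandauSiegel] — **an unrefereed manuscript under adjudication** (ZHANG-L discharge lane, WP16,
chain of the leaf `Typed.Section16A.Eq16_12 c′`). Companion of `Zhang2022/Section16AU018WOfU015W.lean`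
(u015 weighted ⇒ u018 weighted) and `Zhang2022/Section16AEq1612Weighted.lean` ((16.5)ᴾ + (16.10) weighted ⇒
(16.12)); CLAIM nodes: u018 `Step16_u018` [Z22 p. 90, tex L4502], (16.5) `Eq16_5P` [p. 91, tex L4509],
(16.12) `Eq16_12` [p. 92, tex L4558] of `Zhang2022/TypedSection16A.lean`, stated not asserted.

* `eq16_5P_of_u018w` — u018 with error `C·τ₂(k)·𝓛⁻⁸⁰·Dpk` (inline) ⇒ `Eq16_5P c′`: the exact identity
  `main165_eq` (tree) and the error sum `φ(D)⁻¹Σ_{k≤2P₄}|μχ(k)|/(kφ(k))·Cτ₂(k)𝓛⁻⁸⁰Dpk ≤ C𝓛⁻⁸⁰(D/φ(D))p·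
  Σ_kτ₂(k)/φ(k) ≪ 𝓛^{2+36−80}p` (`sum_tau_two_div_totient_le`, `self_div_totient_le_ell_sq`);
* `eq16_5P_of_u015ww`, `eq16_12_of_u015ww_of_eq16_10w` — the compositions: the leaf `Eq16_12 c′` from the two
  honest (weighted, polynomial-rate, on the support of `b₁`) analytic displays u015 and (16.10) of §16 part A.

No new definitions, no named facts, no `sorry`; the weighted displays are hypotheses, never asserted. Nothing here
bears on Theorems 1–2 of the source or on Landau–Siegel zeros.

## References

* Y. Zhang, arXiv:2211.02515v1 (2022), §16 pp. 90–92, u018 tex L4502, (16.5) tex L4509, (16.12) tex L4558.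
  [cite: Zhang2022LandauSiegel, §16 (16.5) p.91]
-/

noncomputable section

open Complex Real
open Literature.NumberTheory.LFunctions.Zhang2022
open Literature.NumberTheory.LFunctions.Zhang2022.Skeleton
open Literature.NumberTheory.LFunctions.Zhang2022.Typed.Section16ALeaves

namespace Literature.NumberTheory.LFunctions.Zhang2022.Typed.Section16A

/-- `log ⌊2P₄⌋ ≤ 522𝓛⁹` for `𝓛 ≥ 1`. [cite: Zhang2022LandauSiegel, §6 p.30 (P₄)] -/
private theorem log_floor_two_P4_le'' {D : ℕ} (hℓ : 1 ≤ ell D) :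
    Real.log (⌊2 * P4 D⌋₊ : ℝ) ≤ 522 * ell D ^ 9 := by
  have hℓ0 : 0 < ell D := by linarith
  have hP0 : 0 < bigP D := Real.exp_pos _
  have ht0 : 0 < t0 D := by rw [t0]; positivity
  have hT1 : 1 ≤ bigT D ^ 2 := one_le_pow₀ (by rw [bigT]; exact Real.one_le_exp (by positivity))
  have hP4le : 2 * P4 D ≤ 2 * (bigP D * t0 D) := by
    rw [P4]
    have : bigP D / bigT D ^ 2 * t0 D ≤ bigP D * t0 D :=
      mul_le_mul_of_nonneg_right (div_le_self hP0.le hT1) ht0.le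
    linarith
  have hℓ9 : 1 ≤ ell D ^ 9 := one_le_pow₀ hℓ
  rcases Nat.eq_zero_or_pos ⌊2 * P4 D⌋₊ with h0 | hpos
  · rw [h0, Nat.cast_zero, Real.log_zero]; positivity
  have hKpos : (0 : ℝ) < (⌊2 * P4 D⌋₊ : ℝ) := by exact_mod_cast hpos
  have hKle : (⌊2 * P4 D⌋₊ : ℝ) ≤ 2 * (bigP D * t0 D) :=
    (Nat.floor_le (by linarith [P4_nonneg D])).trans hP4le
  have hlog2 : Real.log 2 < 1 := by linarith [Real.log_two_lt_d9]
  have hlogt : Real.log (t0 D) ≤ 519 * ell D := by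
    rw [t0, Real.log_pow]
    push_cast
    exact mul_le_mul_of_nonneg_left (Real.log_le_self hℓ0.le) (by norm_num)
  have hℓ9' : ell D ≤ ell D ^ 9 := le_self_pow₀ hℓ (by norm_num)
  calc Real.log (⌊2 * P4 D⌋₊ : ℝ) ≤ Real.log (2 * (bigP D * t0 D)) := Real.log_le_log hKpos hKle
    _ = Real.log 2 + (ell D ^ 9 + Real.log (t0 D)) := by
        rw [Real.log_mul (by norm_num) (by positivity), Real.log_mul hP0.ne' ht0.ne', bigP, Real.log_exp]
    _ ≤ 1 + (ell D ^ 9 + 519 * ell D) := by linarith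
    _ ≤ 522 * ell D ^ 9 := by nlinarith

/-- `⌊2P₄⌋ ≥ 2` for `𝓛 ≥ 2`. [cite: Zhang2022LandauSiegel, §6 p.30] -/
private theorem two_le_floor_two_P4' {D : ℕ} (hℓ : 2 ≤ ell D) : 2 ≤ ⌊2 * P4 D⌋₊ := by
  have hℓ1 : 1 ≤ ell D := by linarith
  have hℓ0 : 0 ≤ ell D := by linarith
  have ha2 : ell D ^ (1.1 : ℝ) ≤ ell D ^ 2 := by
    have h := Real.rpow_le_rpow_of_exponent_le hℓ1 (show (1.1 : ℝ) ≤ 2 by norm_num)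
    rwa [Real.rpow_two] at h
  have h7 : (2 : ℝ) ≤ ell D ^ 7 := by
    calc (2 : ℝ) ≤ 2 ^ 7 := by norm_num
      _ ≤ ell D ^ 7 := by gcongr
  have h9 : 2 * ell D ^ 2 ≤ ell D ^ 9 := by
    have : ell D ^ 9 = ell D ^ 7 * ell D ^ 2 := by ring
    rw [this]; nlinarith [pow_nonneg hℓ0 2]
  have hTP : bigT D ^ 2 ≤ bigP D := by
    rw [bigT, bigP, ← Real.exp_nat_mul, Real.exp_le_exp]
    push_cast
    linarith
  have ht1 : 1 ≤ t0 D := by rw [t0]; exact one_le_pow₀ hℓ1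
  have hT0 : 0 < bigT D ^ 2 := pow_pos (Real.exp_pos _) 2
  have hP4 : 1 ≤ P4 D := by
    rw [P4]
    have h1 : 1 ≤ bigP D / bigT D ^ 2 := by rw [le_div_iff₀ hT0, one_mul]; exact hTP
    calc (1 : ℝ) = 1 * 1 := (mul_one _).symm
      _ ≤ bigP D / bigT D ^ 2 * t0 D := mul_le_mul h1 ht1 zero_le_one (by positivity)
  have h2 : (2 : ℝ) ≤ 2 * P4 D := by linarith
  have : ((2 : ℕ) : ℝ) ≤ 2 * P4 D := by exact_mod_cast h2
  exact Nat.le_floor this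

section Main

variable (c' : ℝ)

/-- **(16.5) in the `o(p)` reading ⇐ u018 with the weight `τ₂(k)` and a polynomial rate** (§16 pp.
90–91, tex L4502–L4515): from u018 with error `C·τ₂(k)·𝓛⁻⁸⁰·Dpk` (inline), `Eq16_5P c′` follows: the `k`
cancels as in `main165_eq`, and the error is `φ(D)⁻¹Σ_{k≤2P₄}|μχ(k)|/(kφ(k))·Cτ₂(k)𝓛⁻⁸⁰Dpk ≤
C𝓛⁻⁸⁰(D/φ(D))p·Σ_{k≤2P₄}τ₂(k)/φ(k) ≪ 𝓛^{−80+2+36}p = o(p)` (`sum_tau_two_div_totient_le`,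
`self_div_totient_le_ell_sq`). [cite: Zhang2022LandauSiegel, §16 (16.5) p.91] -/
theorem eq16_5P_of_u018w
    (h18 : ∃ C : ℝ, ForAllLarge fun D _ χ => AssumptionA D χ →
      ∀ p ∈ primeWindow D, ∀ k : ℕ, 1 ≤ k → (k : ℝ) < 2 * P4 D →
        ‖(∑ d ∈ Finset.Icc 1 ⌊2 * P4 D⌋₊, gTilde16 c' D ((d * k : ℕ) : ℝ) / (d : ℂ) *
              ∑' l : ℕ, if Nat.Coprime l k then
                kappa2Star c' χ (d * l) * χ (l : ZMod D) * DeltaW D ((l : ℝ) / ((D : ℝ) * p * k)) else 0) -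
            calR2star c' χ * ((D : ℝ) * p * k : ℝ) *
              ∑ d₁ ∈ Finset.Icc 1 ⌊2 * P4 D⌋₊, ∑ d₂ ∈ Finset.Icc 1 ⌊2 * P4 D⌋₊,
                gTilde16 c' D ((d₁ * d₂ * k : ℕ) : ℝ) / ((d₁ : ℂ) * d₂) *
                  kappaTilde2 c' χ d₁ (d₂ * k) 1 * lam2 c' χ (d₁ * d₂ * k) 1 *
                  ∑ l₂ ∈ (Finset.Ico 1 ⌈bigP D⌉₊).filter (fun l₂ => Nat.Coprime l₂ k),
                    b1coef c' χ (d₂ * l₂) * χ (l₂ : ZMod D) / (l₂ : ℂ)‖ ≤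
          C * (k.divisors.card : ℝ) * (ell D ^ 80)⁻¹ * ((D : ℝ) * p * k)) :
    Eq16_5P c' := by
  intro ε hε
  obtain ⟨C, h18'⟩ := h18
  set C' : ℝ := max C 0 with hC'
  have hC'0 : 0 ≤ C' := le_max_right _ _
  set M4 : ℝ := MeanSquareMajorant.majorantConst (2 ^ 2) (2 * 2) with hM4
  have hM40 : 0 ≤ M4 := (MeanSquareMajorant.majorantConst_pos _ _).le
  -- the constant in front of `𝓛^{38−80}`
  set M : ℝ := C' * (16 * Real.exp (11 / 2)) * (M4 * 522 ^ 4) with hM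
  have hM0 : 0 ≤ M := by positivity
  obtain ⟨D₁, h₁⟩ := h18'.and (self_div_totient_le_ell_sq)
  obtain ⟨D₂, hD₂⟩ := exists_forall_le_ell (max 10 (M / ε + 1))
  refine ⟨max D₁ D₂, fun D _ χ hD hq hp hA p hpW => ?_⟩
  have hD₁ : D₁ ≤ D := le_trans (le_max_left _ _) hD
  have hℓM := hD₂ D (le_trans (le_max_right _ _) hD)
  have hℓ10 : 10 ≤ ell D := le_trans (le_max_left _ _) hℓM
  have hℓε : M / ε + 1 ≤ ell D := le_trans (le_max_right _ _) hℓM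
  have hℓ1 : 1 ≤ ell D := by linarith
  have hℓ0 : 0 < ell D := by linarith
  obtain ⟨e18, eφ⟩ := h₁ D χ hD₁ hq hp
  have h18p := e18 hA p hpW
  have hφle := eφ hA
  set K : ℕ := ⌊2 * P4 D⌋₊ with hK
  set N : ℕ := ⌈bigP D⌉₊ with hN
  set R : ℂ := calR2star c' χ with hR
  have hp0 : 0 < p := (Finset.mem_filter.mp hpW).2.pos
  have hpR : (0 : ℝ) < p := by exact_mod_cast hp0
  have hD0 : (0 : ℝ) < D := by exact_mod_cast NeZero.pos D
  have hφ0 : 0 < (Nat.totient D : ℝ) := by exact_mod_cast Nat.totient_pos.mpr (NeZero.pos D)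
  have hα0 : 0 ≤ alpha D := (alpha_pos_of_ell_pos hℓ0).le
  -- the two `k`-indexed families of u018
  set A : ℕ → ℂ := fun k => ∑ d ∈ Finset.Icc 1 K, gTilde16 c' D ((d * k : ℕ) : ℝ) / (d : ℂ) *
      ∑' l : ℕ, if Nat.Coprime l k then
        kappa2Star c' χ (d * l) * χ (l : ZMod D) * DeltaW D ((l : ℝ) / ((D : ℝ) * p * k)) else 0
    with hA
  set B : ℕ → ℂ := fun k => ∑ d₁ ∈ Finset.Icc 1 K, ∑ d₂ ∈ Finset.Icc 1 K,
      gTilde16 c' D ((d₁ * d₂ * k : ℕ) : ℝ) / ((d₁ : ℂ) * d₂) *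
        kappaTilde2 c' χ d₁ (d₂ * k) 1 * lam2 c' χ (d₁ * d₂ * k) 1 *
        ∑ l₂ ∈ (Finset.Ico 1 N).filter (fun l₂ => Nat.Coprime l₂ k),
          b1coef c' χ (d₂ * l₂) * χ (l₂ : ZMod D) / (l₂ : ℂ) with hB
  -- per-`k` bound (the edge `k = 2P₄` included: there both sides vanish)
  set r : ℝ := (ell D ^ 80)⁻¹ with hr
  have hr0 : 0 < r := by positivity
  have hk : ∀ k ∈ Finset.Icc 1 K,
      ‖A k - R * ((D : ℝ) * p * k : ℝ) * B k‖ ≤ C' * (k.divisors.card : ℝ) * r * ((D : ℝ) * p * k) := by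
    intro k hkK
    have hk1 : 1 ≤ k := (Finset.mem_Icc.mp hkK).1
    by_cases hlt : (k : ℝ) < 2 * P4 D
    · refine (h18p k hk1 hlt).trans ?_
      have h0 : 0 ≤ (k.divisors.card : ℝ) * r * ((D : ℝ) * p * k) := by positivity
      calc C * (k.divisors.card : ℝ) * r * ((D : ℝ) * p * k)
          = C * ((k.divisors.card : ℝ) * r * ((D : ℝ) * p * k)) := by ring
        _ ≤ C' * ((k.divisors.card : ℝ) * r * ((D : ℝ) * p * k)) :=
            mul_le_mul_of_nonneg_right (le_max_left _ _) h0
        _ = C' * (k.divisors.card : ℝ) * r * ((D : ℝ) * p * k) := by ring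
    · have hge : 2 * P4 D ≤ k := not_lt.mp hlt
      have hg : ∀ n : ℕ, 1 ≤ n → gTilde16 c' D ((n * k : ℕ) : ℝ) = 0 := by
        intro n hn
        have hnk : (k : ℝ) ≤ ((n * k : ℕ) : ℝ) := by exact_mod_cast Nat.le_mul_of_pos_left k hn
        exact gTilde16_eq_zero_of_le c' (by positivity) (hge.trans hnk)
      have hA0 : A k = 0 := Finset.sum_eq_zero fun d hd => by
        rw [hg d (Finset.mem_Icc.mp hd).1, zero_div, zero_mul]
      have hB0 : B k = 0 := Finset.sum_eq_zero fun d₁ hd₁ => Finset.sum_eq_zero fun d₂ hd₂ => by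
        rw [hg (d₁ * d₂) (Nat.one_le_iff_ne_zero.mpr (Nat.mul_ne_zero
          (by linarith [(Finset.mem_Icc.mp hd₁).1]) (by linarith [(Finset.mem_Icc.mp hd₂).1]))),
          zero_div, zero_mul, zero_mul, zero_mul]
      rw [hA0, hB0, mul_zero, sub_zero, norm_zero]
      positivity
  -- (16.3) unfolded
  have hPhi : Phi2p c' χ p = (Nat.totient D : ℂ)⁻¹ * ∑ k ∈ Finset.Icc 1 K,
      (ArithmeticFunction.moebius k : ℂ) * χ (k : ZMod D) / ((k : ℂ) * Nat.totient k) * A k := rfl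
  -- the main term, `k` cancelled, and `main165_eq`
  have hmainK : ∀ k ∈ Finset.Icc 1 K,
      (Nat.totient D : ℂ)⁻¹ * ((ArithmeticFunction.moebius k : ℂ) * χ (k : ZMod D) /
        ((k : ℂ) * Nat.totient k) * (R * ((D : ℝ) * p * k : ℝ) * B k)) =
      R * ((D : ℝ) * p : ℝ) / (Nat.totient D : ℂ) *
        ((ArithmeticFunction.moebius k : ℂ) * χ (k : ZMod D) / (Nat.totient k : ℂ) * B k) := by
    intro k hkK
    have hk0 : (k : ℂ) ≠ 0 := by exact_mod_cast (show k ≠ 0 by linarith [(Finset.mem_Icc.mp hkK).1])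
    have hφk : (Nat.totient k : ℂ) ≠ 0 := by
      exact_mod_cast (Nat.totient_pos.mpr (by linarith [(Finset.mem_Icc.mp hkK).1])).ne'
    have hφD : (Nat.totient D : ℂ) ≠ 0 := by exact_mod_cast hφ0.ne'
    push_cast
    field_simp
  have hmain : (Nat.totient D : ℂ)⁻¹ * ∑ k ∈ Finset.Icc 1 K,
      (ArithmeticFunction.moebius k : ℂ) * χ (k : ZMod D) / ((k : ℂ) * Nat.totient k) *
        (R * ((D : ℝ) * p * k : ℝ) * B k) =
      R * ((D : ℝ) * p : ℝ) / (Nat.totient D : ℂ) *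
        ∑ d ∈ Finset.Ico 1 N, ∑ l ∈ Finset.Ico 1 N,
          b1coef c' χ (d * l) * χ (l : ZMod D) / ((d : ℂ) * l) * calD2 c' χ d l := by
    rw [← main165_eq c' χ hℓ10, Finset.mul_sum, Finset.mul_sum]
    exact Finset.sum_congr rfl hmainK
  -- the difference
  have hdiff : Phi2p c' χ p - R * ((D : ℝ) * p : ℝ) / (Nat.totient D : ℂ) *
      ∑ d ∈ Finset.Ico 1 N, ∑ l ∈ Finset.Ico 1 N,
        b1coef c' χ (d * l) * χ (l : ZMod D) / ((d : ℂ) * l) * calD2 c' χ d l =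
      (Nat.totient D : ℂ)⁻¹ * ∑ k ∈ Finset.Icc 1 K,
        (ArithmeticFunction.moebius k : ℂ) * χ (k : ZMod D) / ((k : ℂ) * Nat.totient k) *
          (A k - R * ((D : ℝ) * p * k : ℝ) * B k) := by
    rw [hPhi, ← hmain, ← mul_sub, ← Finset.sum_sub_distrib]
    congr 1
    refine Finset.sum_congr rfl fun k _ => ?_
    ring
  rw [hdiff]
  -- norms
  have hcoef : ∀ k ∈ Finset.Icc 1 K,
      ‖(ArithmeticFunction.moebius k : ℂ) * χ (k : ZMod D) / ((k : ℂ) * Nat.totient k) *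
          (A k - R * ((D : ℝ) * p * k : ℝ) * B k)‖ ≤
        C' * r * ((D : ℝ) * p) * (MeanSquareMajorant.tau 2 k / (Nat.totient k : ℝ)) := by
    intro k hkK
    have hk1 : 1 ≤ k := (Finset.mem_Icc.mp hkK).1
    have hkR : (0 : ℝ) < k := by exact_mod_cast hk1
    have hφk : (0 : ℝ) < Nat.totient k := by exact_mod_cast Nat.totient_pos.mpr hk1
    have hμ : ‖(ArithmeticFunction.moebius k : ℂ)‖ ≤ 1 := by
      rw [Complex.norm_intCast]; exact_mod_cast ArithmeticFunction.abs_moebius_le_one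
    have hχ : ‖χ (k : ZMod D)‖ ≤ 1 := DirichletCharacter.norm_le_one χ _
    have hc : ‖(ArithmeticFunction.moebius k : ℂ) * χ (k : ZMod D) / ((k : ℂ) * Nat.totient k)‖ ≤
        1 / ((k : ℝ) * Nat.totient k) := by
      rw [norm_div, norm_mul, norm_mul, Complex.norm_natCast, Complex.norm_natCast]
      refine div_le_div_of_nonneg_right ?_ (by positivity)
      calc ‖(ArithmeticFunction.moebius k : ℂ)‖ * ‖χ (k : ZMod D)‖ ≤ 1 * 1 :=
            mul_le_mul hμ hχ (norm_nonneg _) zero_le_one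
        _ = 1 := one_mul _
    have hτk : (k.divisors.card : ℝ) = MeanSquareMajorant.tau 2 k := (MeanSquareMajorant.tau_two_apply k).symm
    rw [norm_mul]
    calc ‖(ArithmeticFunction.moebius k : ℂ) * χ (k : ZMod D) / ((k : ℂ) * Nat.totient k)‖ *
          ‖A k - R * ((D : ℝ) * p * k : ℝ) * B k‖
        ≤ 1 / ((k : ℝ) * Nat.totient k) * (C' * (k.divisors.card : ℝ) * r * ((D : ℝ) * p * k)) :=
          mul_le_mul hc (hk k hkK) (norm_nonneg _) (by positivity)
      _ = C' * r * ((D : ℝ) * p) * (MeanSquareMajorant.tau 2 k / (Nat.totient k : ℝ)) := by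
          rw [hτk]; field_simp
  have hnorminv : ‖(Nat.totient D : ℂ)⁻¹‖ = (Nat.totient D : ℝ)⁻¹ := by
    rw [norm_inv, Complex.norm_natCast]
  have hK2 : 2 ≤ K := two_le_floor_two_P4' (by linarith)
  have hsumφ : ∑ k ∈ Finset.Icc 1 K, MeanSquareMajorant.tau 2 k / (Nat.totient k : ℝ) ≤
      M4 * Real.log (K : ℝ) ^ (2 ^ 2) := sum_tau_two_div_totient_le hK2
  have hlogK : Real.log (K : ℝ) ≤ 522 * ell D ^ 9 := log_floor_two_P4_le'' hℓ1
  have hlogK0 : 0 ≤ Real.log (K : ℝ) := Real.log_natCast_nonneg K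
  have hsumφ' : ∑ k ∈ Finset.Icc 1 K, MeanSquareMajorant.tau 2 k / (Nat.totient k : ℝ) ≤
      M4 * (522 * ell D ^ 9) ^ 4 := by
    refine hsumφ.trans ?_
    rw [show (2 : ℕ) ^ 2 = 4 by norm_num]
    exact mul_le_mul_of_nonneg_left (pow_le_pow_left₀ hlogK0 hlogK 4) hM40
  have hsum0 : 0 ≤ ∑ k ∈ Finset.Icc 1 K, MeanSquareMajorant.tau 2 k / (Nat.totient k : ℝ) :=
    Finset.sum_nonneg fun k _ => div_nonneg (MeanSquareMajorant.tau_nonneg _ _) (Nat.cast_nonneg _)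
  -- `r · 𝓛^{2+36} = 𝓛^{38}/𝓛^{80} ≤ 1/𝓛`
  have hrate : r * (ell D ^ 2 * (ell D ^ 9) ^ 4) ≤ 1 / ell D := by
    simp only [hr]
    rw [← pow_mul, ← pow_add, inv_mul_le_iff₀ (pow_pos hℓ0 80), one_div, ← div_eq_mul_inv,
      le_div_iff₀ hℓ0, ← pow_succ]
    exact pow_le_pow_right₀ hℓ1 (by norm_num)
  calc ‖(Nat.totient D : ℂ)⁻¹ * ∑ k ∈ Finset.Icc 1 K,
        (ArithmeticFunction.moebius k : ℂ) * χ (k : ZMod D) / ((k : ℂ) * Nat.totient k) *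
          (A k - R * ((D : ℝ) * p * k : ℝ) * B k)‖
      ≤ (Nat.totient D : ℝ)⁻¹ * ∑ k ∈ Finset.Icc 1 K,
          C' * r * ((D : ℝ) * p) * (MeanSquareMajorant.tau 2 k / (Nat.totient k : ℝ)) := by
        rw [norm_mul, hnorminv]
        exact mul_le_mul_of_nonneg_left ((norm_sum_le _ _).trans (Finset.sum_le_sum hcoef))
          (by positivity)
    _ = C' * r * ((D : ℝ) / (Nat.totient D : ℝ)) * p *
          ∑ k ∈ Finset.Icc 1 K, MeanSquareMajorant.tau 2 k / (Nat.totient k : ℝ) := by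
        rw [← Finset.mul_sum]; field_simp
    _ ≤ C' * r * (16 * Real.exp (11 / 2) * ell D ^ 2) * p * (M4 * (522 * ell D ^ 9) ^ 4) := by
        have h0 : 0 ≤ C' * r := by positivity
        exact mul_le_mul (mul_le_mul_of_nonneg_right (mul_le_mul_of_nonneg_left hφle h0) hpR.le) hsumφ'
          hsum0 (by positivity)
    _ = M * (r * (ell D ^ 2 * (ell D ^ 9) ^ 4)) * p := by
        simp only [hM]; ring
    _ ≤ M * (1 / ell D) * p :=
        mul_le_mul_of_nonneg_right (mul_le_mul_of_nonneg_left hrate hM0) hpR.le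
    _ = M / ell D * p := by rw [mul_one_div]
    _ ≤ ε * p := by
        refine mul_le_mul_of_nonneg_right ?_ hpR.le
        rw [div_le_iff₀ hℓ0]
        have h1 : M / ε ≤ ell D := by linarith
        have h2 := (div_le_iff₀ hε).mp h1
        linarith


/-- **(16.5)ᴾ ⇐ u015 (weighted, polynomial rate, on the support of `b₁`)**: the composition
`eq16_5P_of_u018w ∘ step16_u018w_of_u015ww`. [cite: Zhang2022LandauSiegel, §16 (16.5) p.91] -/
theorem eq16_5P_of_u015ww
    (h15 : ∃ c₀ C : ℝ, ForAllLarge fun D _ χ => AssumptionA D χ →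
      ∀ p ∈ primeWindow D, ∀ d₁ d₂ k l₂ : ℕ, 1 ≤ d₁ → 1 ≤ d₂ → 1 ≤ k → 1 ≤ l₂ →
        (l₂ : ℝ) < 2 * bigT D ^ 2 * (bigP D ^ (1 / 2 : ℝ) * max (Skeleton.P2 D) (P3 D)) →
        ((d₁ * d₂ * k : ℕ) : ℝ) < 2 * P4 D →
        ‖(∑' l₁ : ℕ, if Nat.Coprime l₁ (d₂ * k) then
              kappa2 c' D (d₁ * l₁) * χ (l₁ : ZMod D) *
                DeltaW D (((l₁ * l₂ : ℕ) : ℝ) / ((D : ℝ) * p * k))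
            else 0) -
            calR2star c' χ * (((D : ℝ) * p * k / l₂ : ℝ) : ℂ) * kappaTilde2 c' χ d₁ (d₂ * k) 1 *
              lam2 c' χ (d₁ * d₂ * k) 1‖ ≤
          C * (d₁.divisors.card : ℝ) * (∏ q ∈ (d₁ * d₂ * k).primeFactors, (1 + c₀ / (q : ℝ) ^ (9 / 10 : ℝ))) *
            (ell D ^ 200)⁻¹ * ((D : ℝ) * p * k / l₂)) :
    Eq16_5P c' :=
  eq16_5P_of_u018w c' (step16_u018w_of_u015ww c' h15)

/-- **(16.12) ⇐ u015 (weighted) + (16.10) (weighted)**, both on the support of `b₁` with polynomial rates: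
the composition `eq16_12_of_eq16_5P_of_eq16_10_weighted ∘ eq16_5P_of_u015ww` — the leaf `Eq16_12 c′`
from the two honest analytic displays of §16 part A. [cite: Zhang2022LandauSiegel, §16 (16.12) p.92] -/
theorem eq16_12_of_u015ww_of_eq16_10w
    (h15 : ∃ c₀ C : ℝ, ForAllLarge fun D _ χ => AssumptionA D χ →
      ∀ p ∈ primeWindow D, ∀ d₁ d₂ k l₂ : ℕ, 1 ≤ d₁ → 1 ≤ d₂ → 1 ≤ k → 1 ≤ l₂ →
        (l₂ : ℝ) < 2 * bigT D ^ 2 * (bigP D ^ (1 / 2 : ℝ) * max (Skeleton.P2 D) (P3 D)) →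
        ((d₁ * d₂ * k : ℕ) : ℝ) < 2 * P4 D →
        ‖(∑' l₁ : ℕ, if Nat.Coprime l₁ (d₂ * k) then
              kappa2 c' D (d₁ * l₁) * χ (l₁ : ZMod D) *
                DeltaW D (((l₁ * l₂ : ℕ) : ℝ) / ((D : ℝ) * p * k))
            else 0) -
            calR2star c' χ * (((D : ℝ) * p * k / l₂ : ℝ) : ℂ) * kappaTilde2 c' χ d₁ (d₂ * k) 1 *
              lam2 c' χ (d₁ * d₂ * k) 1‖ ≤
          C * (d₁.divisors.card : ℝ) * (∏ q ∈ (d₁ * d₂ * k).primeFactors, (1 + c₀ / (q : ℝ) ^ (9 / 10 : ℝ))) *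
            (ell D ^ 200)⁻¹ * ((D : ℝ) * p * k / l₂))
    (h10 : ∃ c₀ C : ℝ, ForAllLarge fun D _ χ => AssumptionA D χ →
      ∀ d l : ℕ, 1 ≤ d → 1 ≤ l →
        ((d * l : ℕ) : ℝ) < 2 * bigT D ^ 2 * (bigP D ^ (1 / 2 : ℝ) * max (Skeleton.P2 D) (P3 D)) →
        Nat.Coprime l D →
        ‖calD2 c' χ d l - lam2 c' χ d 1 * ∑ j ∈ ({1, 2} : Finset ℕ),
            calR2 c' χ j * (d : ℂ) ^ betaJ c' D j * calM2 c' χ d l (1 - betaJ c' D j)‖ ≤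
          C * (∏ q ∈ (d * l).primeFactors, (1 + c₀ / (q : ℝ) ^ (9 / 10 : ℝ))) * (ell D ^ 120)⁻¹) :
    Eq16_12 c' :=
  eq16_12_of_eq16_5P_of_eq16_10_weighted c' (eq16_5P_of_u015ww c' h15) h10

end Main

end Literature.NumberTheory.LFunctions.Zhang2022.Typed.Section16A
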